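import Summits.AtomisticToContinuum.Crystallization.Theses.ReggeStarCoercivity
import Literature.MathematicalPhysics.StatisticalMechanics.PeriodicConfigurationSums

/-!
# Line `pinned-equilibria-reduction` for crux `PeriodicStarCoercivity` (stmt-AtomisticToContinuum-13602) — rev 1 (planner)

Crux (route `ReggeStarCoercivity`, rank 4; Blanc–Lewin units `V = r⁻¹²/12 − r⁻⁶/6`):
`∃ g > 0, ∀ P : PeriodicConfiguration 3, ePer + g·#def(P)/#motif(P) ≤ e_LJ(P)`, a motif site `s` being
DEFECTIVE unless its recentred shell (other points of `P.points` within absolute radius `6/5`), rescaled by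
`a⁻¹` for some `a ∈ [9/10, 11/10]`, is `1/20`-`ShellCloseTo` the fcc or the hcp kissing pattern.

Idea (card `Ideas/pinned-equilibria-reduction.md`, triage r1 ×3 pass as the competitor-side module of the
same-word line): VARY THE COMPETITOR, NOT THE BOUND.  The charge is piecewise constant in the coordinates of
`P`, so every periodic `P` can be replaced — at frozen defect statuses, with no increase of energy — by an
`(ε, ρ)`-PINNED EQUILIBRIUM (`stub_frozenDescent`: zero sublattice force at every `ρ`-robustly classified
site, zero cell stress whenever the whole classification is `ρ`-robust under affine moves; finite descent,
no Ekeland — triage r1-1/r1-3).  The crux then only has to be proved ON EQUILIBRIA (`CruxOnEquilibria`, the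
card's transfer `C⁺`, here PROVED equivalent modulo the descent: `of_parts`), and on equilibria it is cut
along the near/far seam of the same-word line into crux-implied (hence unrefutable-unless-the-crux-is)
regime statements:

* CLEAN NEAR WORLD (every site `7/100`-near a Barlow shell): `stub_cleanNearCoercivity` — the certified
  phonon gap of the Lennard-Jones Barlow stackings against the shell-distortion form, booked against `ePer`
  through the relaxation of `P`'s OWN stacking word (same-word reference; `comparative` below); this is where
  the binding competitors live (hcp threshold shuffle, `g* ≲ 4.3e-3`, TRIAGE r1-3 N1) and where, on the
  binding family, the equilibrium hypothesis is VACUOUS (threshold-pinned sites are not robust) — honest label.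
* CONTAMINATED WORLD, near side: near-defective sites still pay `c` each, up to a loss linear in the number
  of far-defective sites (`NearCoercivityModCollar`, PROVED here from two stubs): `stub_isolatedNearDefectsPay`
  — the LOCAL form of the phonon gap around near-defective sites farther than `R` from all junk (unpinned near
  sites of an equilibrium are exact elastic solutions — the card's "no mushy middle") — and `stub_collarCount` —
  the packing count `#collar(R) ≤ C R³ · #far` (`7/100`-near sites are centres of disjoint balls of radius
  `0.418`; provable now).
* CONTAMINATED WORLD, far side: `stub_farHealingOnEquilibria` — far-defective sites pay `c' ≈ 10⁻²` each
  against `ePer` (healing inequality: cut junk ∪ collar, patch with reference material, compare; or the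
  route's edge- and vertex-star LP at `10⁻²` slack against the explicit `e(hcp) ≥ ePer`), now WITH the free LP
  rows this line supplies: three force-balance equations per robust junk star and six zero-stress equations
  per robust cell (kills rattler / porous / lopsided stars and every flatness-feasible but mechanically
  unrealisable froth statistics; bcc, A15, σ survive, as they must).

`PeriodicStarCoercivity_of` concludes the route decl BY NAME from the five registered stubs; the glue
(`of_parts`: descent ∘ case split clean/contaminated ∘ collar bookkeeping ∘ convex combination of the two contaminated-world
inequalities ∘ `#def = #nearDef + #farDef`) is sorry-free.  Honours `Cruxes/PeriodicStarCoercivity/Disproof.lean`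
(gen 2 v4, RESISTS, no `_false_without_` theorem): tolerance `1/20`, the FRACTION and the scale window are
carried verbatim (`psc_iff` is `Iff.rfl`); no stub is the per-site strengthening `SiteCoercivity` (§5.1); every
regime stub is implied by the crux (certificates `cleanNear_of_crux`, `isolated_of_crux`, `farHealing_of_crux`; `stub_collarCount` is a theorem of packing geometry
below), so none is an instance of the refuted strengthenings `not_pscWith_zero` / `not_pscCount` /
`not_periodicStarCoercivityForallG` / `not_pscAt_three_fifths`.
-/

noncomputable section

open scoped BigOperators Classical
open Literature.MathematicalPhysics.StatisticalMechanics Literature.Geometry.DiscreteGeometry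

namespace Summit.AtomisticToContinuum.Crystallization.Cruxes.PeriodicStarCoercivity.PinnedEquilibriaReduction

local notation "E3" => EuclideanSpace ℝ (Fin 3)
local notation "PC" => PeriodicConfiguration 3

/-! ## §0 Vocabulary — verbatim sub-terms of the crux (sorry-free; split out unchanged if a Theorems file needs it) -/

/-- The recentred first shell of `s` in `P` (other points within ABSOLUTE radius `6/5`), rescaled by `a⁻¹` —
literally the sub-term of the route decl. -/
def shell (P : PC) (s : E3) (a : ℝ) : Finset E3 :=
  (P.finite_inter_points (K := Metric.closedBall s (6 / 5) \ {s})
      (Metric.isBounded_closedBall.subset Set.sdiff_subset)).toFinset.image fun y => a⁻¹ • (y - s)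

/-- `s` is `η`-NEAR a Barlow shell in `P`: some admissible rescaling `a ∈ [9/10, 11/10]` of its shell is
`η`-`ShellCloseTo` the fcc or the hcp kissing pattern (crux: `η = 1/20`; near/far seam: `η = 7/100`). -/
def Near (η : ℝ) (P : PC) (s : E3) : Prop :=
  ∃ a : ℝ, 9 / 10 ≤ a ∧ a ≤ 11 / 10 ∧
    (ShellCloseTo η (shell P s a) fccKissingPattern ∨ ShellCloseTo η (shell P s a) hcpKissingPattern)

/-- FREE (non-defective) site of the crux = `1/20`-near. -/
def IsFree (P : PC) (s : E3) : Prop := Near (1 / 20) P s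

/-- Lennard-Jones energy per particle. -/
def e (P : PC) : ℝ := P.energyPerParticle lennardJones

/-- `ePer = ⨅_Q e(Q)` over all periodic configurations of `ℝ³`. -/
def ePer : ℝ := ⨅ Q : PC, Q.energyPerParticle lennardJones

/-- Defective motif sites (the crux's charge set). -/
def defectSet (P : PC) : Finset E3 := P.motif.filter fun s => ¬ IsFree P s

/-- NEAR-DEFECTIVE sites: defective but `7/100`-near (threshold-pinned / strained Barlow shells). -/
def nearDefSet (P : PC) : Finset E3 := (defectSet P).filter fun s => Near (7 / 100) P s

/-- FAR-DEFECTIVE sites ("junk"): defective and not even `7/100`-near (wrong coordination, 5-rings, bcc/A15/σ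
stars, ≥ 7 %-strained shells). -/
def farDefSet (P : PC) : Finset E3 := (defectSet P).filter fun s => ¬ Near (7 / 100) P s

/-- The crux's defect fraction and its two parts. -/
def defectFrac (P : PC) : ℝ := ((defectSet P).card : ℝ) / (P.motif.card : ℝ)
def ndFrac (P : PC) : ℝ := ((nearDefSet P).card : ℝ) / (P.motif.card : ℝ)
def fdFrac (P : PC) : ℝ := ((farDefSet P).card : ℝ) / (P.motif.card : ℝ)

/-- The body of the crux at `g`, in the route decl's own left-associated form `g * #def / #motif`. -/
def PSCAt (g : ℝ) (P : PC) : Prop :=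
  ePer + g * ((defectSet P).card : ℝ) / (P.motif.card : ℝ) ≤ e P

/-- The route decl IS `∃ g > 0, ∀ P, PSCAt g P` — definitional unfolding only (the crux is fixed). -/
theorem psc_iff :
    Summit.AtomisticToContinuum.Crystallization.Theses.ReggeStarCoercivity.PeriodicStarCoercivity ↔
      ∃ g : ℝ, 0 < g ∧ ∀ P : PC, PSCAt g P :=
  Iff.rfl

/-! ## §1 Equilibrium vocabulary (the lever: vary the competitor) -/

/-- The FORCE on the sublattice through `s`: `∑_{y ∈ P.points, y ∉ s + G} V'(|s − y|)·(y − s)/|s − y|`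
(points of the same sublattice co-move and drop out; `∇_{s ↦ s+u} e = −⟪force, u⟫/#motif`). -/
def force (P : PC) (s : E3) : E3 :=
  ∑' y : {y : E3 // y ∈ P.points ∧ y - s ∉ P.lattice},
    (deriv lennardJones (dist s y.1) / dist s y.1) • (y.1 - s)

/-- The VIRIAL of `P` against a strain rate `B` (first variation of `e` under `x ↦ x + B x`, lattice and
motif moving together): `(2 #motif)⁻¹ ∑_{x ∈ motif} ∑_{y ≠ x} V'(|x − y|) ⟪x − y, B(x − y)⟫ / |x − y|`.
Zero virial for all `B` = zero Cauchy stress of the cell (six equations; triage r1-2 (2), r1-3 sharpen). -/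
def virial (P : PC) (B : E3 →L[ℝ] E3) : ℝ :=
  (2 * (P.motif.card : ℝ))⁻¹ * ∑ x ∈ P.motif,
    ∑' y : {y : E3 // y ∈ P.points ∧ y ≠ x},
      deriv lennardJones (dist x y.1) * (inner ℝ (x - y.1) (B (x - y.1)) / dist x y.1)

/-- `P'` is `P` with the sublattice through `s` moved so as to pass through `t` (same lattice). -/
def IsMove (P : PC) (s t : E3) (P' : PC) : Prop :=
  P'.lattice = P.lattice ∧ P'.motif = insert t (P.motif.erase s)

/-- The two statuses the charge reads (`1/20`-free, `7/100`-near) agree at `s` in `P` and at `t` in `P'`. -/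
def SameStatus (P : PC) (s : E3) (P' : PC) (t : E3) : Prop :=
  (IsFree P s ↔ IsFree P' t) ∧ (Near (7 / 100) P s ↔ Near (7 / 100) P' t)

/-- `s` is `ρ`-ROBUSTLY classified in `P`: moving the sublattice of `s` by less than `ρ` changes the status of
no motif site (so neither `s` nor any site whose shell contains a translate of `s` is pinned at a threshold).
Antitone in `ρ`. -/
def Robust (ρ : ℝ) (P : PC) (s : E3) : Prop :=
  ∀ (t : E3) (P' : PC), dist t s < ρ → IsMove P s t P' →
    SameStatus P s P' t ∧ ∀ s' ∈ P.motif, s' ≠ s → SameStatus P s' P' s'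

/-- The whole classification of `P` is `ρ`-robust under AFFINE moves: every linear `A` with `‖A − 1‖ < ρ`
changes the status of no site (statuses read in the image point set `A '' P.points`). Antitone in `ρ`. -/
def MetricRobust (ρ : ℝ) (P : PC) : Prop :=
  ∀ (A : E3 →L[ℝ] E3) (P'' : PC), ‖A - 1‖ < ρ → P''.points = A '' P.points →
    ∀ s ∈ P.motif, SameStatus P s P'' (A s)

/-- `(ε, ρ)`-PINNED EQUILIBRIUM: sublattice force `≤ ε` at every `ρ`-robust site, and virial `≤ ε‖B‖` for
every strain rate `B` whenever the whole classification is `ρ`-metric-robust.  Monotone UP in `ε` and `ρ`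
(`Equilibrated.mono`), which is what lets `of_parts` serve several regime lemmas with one descent. -/
def Equilibrated (ε ρ : ℝ) (P : PC) : Prop :=
  (∀ s ∈ P.motif, Robust ρ P s → ‖force P s‖ ≤ ε) ∧
    (MetricRobust ρ P → ∀ B : E3 →L[ℝ] E3, |virial P B| ≤ ε * ‖B‖)

/-! ## §1b Collar vocabulary (contaminated world: where the junk is, seen from the near matrix) -/

/-- A far-defective POINT of `P` (any point of `P.points`, not only motif representatives; the status is
`G`-invariant). -/
def IsFarDef (P : PC) (y : E3) : Prop := ¬ IsFree P y ∧ ¬ Near (7 / 100) P y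

/-- `s` is `R`-ISOLATED from the junk of `P`: every far-defective point of `P` is at distance `≥ R`. -/
def Isolated (R : ℝ) (P : PC) (s : E3) : Prop := ∀ y ∈ P.points, IsFarDef P y → R ≤ dist s y

/-- Near-defective motif sites that are `R`-isolated from the junk (they must pay by LOCAL rigidity). -/
def isolatedNearDefSet (R : ℝ) (P : PC) : Finset E3 := (nearDefSet P).filter fun s => Isolated R P s

/-- The `R`-COLLAR: `7/100`-near motif sites (free or near-defective) within `R` of some far-defective point. -/
def collarSet (R : ℝ) (P : PC) : Finset E3 :=
  P.motif.filter fun s => Near (7 / 100) P s ∧ ¬ Isolated R P s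

/-! ## §2 The regime statements, named (each OPEN one is registered below as a `stub_…` with the same body) -/

/-- S1 — frozen-status descent to pinned equilibria. -/
def FrozenDescent : Prop :=
  ∀ P : PC, ∀ ε > (0 : ℝ), ∀ ρ > (0 : ℝ), ∃ P' : PC,
    e P' ≤ e P ∧ ndFrac P' = ndFrac P ∧ fdFrac P' = fdFrac P ∧ Equilibrated ε ρ P'

/-- S2 — clean near world: coercivity of equilibria all of whose sites are `7/100`-near. -/
def CleanNearCoercivity : Prop :=
  ∃ c > (0 : ℝ), ∃ ε > (0 : ℝ), ∃ ρ > (0 : ℝ), ∀ P : PC, Equilibrated ε ρ P →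
    (∀ s ∈ P.motif, Near (7 / 100) P s) → ePer + c * ndFrac P ≤ e P

/-- S3 — contaminated world, near side, LOCAL form: near-defective sites `R`-isolated from the junk pay `c` each. -/
def IsolatedNearDefectsPay : Prop :=
  ∃ c > (0 : ℝ), ∃ R ≥ (1 : ℝ), ∃ ε > (0 : ℝ), ∃ ρ > (0 : ℝ), ∀ P : PC, Equilibrated ε ρ P →
    0 < fdFrac P → ePer + c * (((isolatedNearDefSet R P).card : ℝ) / (P.motif.card : ℝ)) ≤ e P

/-- S5 — collar count (pure packing geometry of near sites): `#collar(R) ≤ C R³ · #farDef`. -/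
def CollarCount : Prop :=
  ∃ C : ℝ, ∀ R : ℝ, 1 ≤ R → ∀ P : PC,
    ((collarSet R P).card : ℝ) ≤ C * R ^ 3 * ((farDefSet P).card : ℝ)

/-- S3 ⊕ S5, the form the gluing consumes — contaminated world, near side: near-defective sites pay, modulo a
collar loss linear in the junk (PROVED from S3 and S5 below: `modCollar_of_isolated_of_collar`). -/
def NearCoercivityModCollar : Prop :=
  ∃ c > (0 : ℝ), ∃ A ≥ (0 : ℝ), ∃ ε > (0 : ℝ), ∃ ρ > (0 : ℝ), ∀ P : PC, Equilibrated ε ρ P →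
    0 < fdFrac P → ePer + c * ndFrac P - A * fdFrac P ≤ e P

/-- S4 — contaminated world, far side: junk pays against `ePer` (healing inequality on equilibria). -/
def FarHealingOnEquilibria : Prop :=
  ∃ c > (0 : ℝ), ∃ ε > (0 : ℝ), ∃ ρ > (0 : ℝ), ∀ P : PC, Equilibrated ε ρ P →
    0 < fdFrac P → ePer + c * fdFrac P ≤ e P

/-- The card's transfer `C⁺`: the crux demanded only of `(ε, ρ)`-pinned equilibria. -/
def CruxOnEquilibria : Prop :=
  ∃ g > (0 : ℝ), ∃ ε > (0 : ℝ), ∃ ρ > (0 : ℝ), ∀ P : PC, Equilibrated ε ρ P →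
    ePer + g * defectFrac P ≤ e P

/-! ## §3 Registered stubs -/

/-- **stub S1 — FROZEN-STATUS DESCENT (the lever; size M; TRUE, elementary).** Every periodic `P` can be
replaced, for any `ε, ρ > 0`, by a periodic `P'` with energy no larger, the SAME near-defective and
far-defective fractions, and `(ε, ρ)`-equilibrated.  Proof (triage r1-3, sharpening the card's Ekeland/
`cl(W°)` plan, which fails in a radius-`6/5` corner — r1-2 sharpen (1)): finite descent — while some
`ρ`-robust site has `‖force‖ > ε`, move its sublattice by `ℓ = min(ρ/2, ε/2L)` along the force (statuses, hence
both fractions, unchanged by robustness; `e` drops by `≥ ℓε/2n`); while the classification is `ρ`-metric-robust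
and `|virial B| > ε‖B‖`, apply `1 ∓ tB`, `t‖B‖ = min(ρ/2, ε/L')` (statuses unchanged; `e` drops by
`≥ εt‖B‖/2`); `e ≤ e(P)` along the way bounds the minimal distance below (n fixed), hence the Hessian
constants `L, L'` (lattice sums of `|V''|r² + |V'|r`, `summable_lennardJones_dist_three`-type), and `e` is
bounded below (periodic stability, shared item 0714 / evidence `PeriodicStability.lean`), so the descent
stops.  Degenerate instances: no robust site ⇒ `P' := P`; Bravais `P` ⇒ `force ≡ 0` (empty index type),
only the stress row bites.  Uses: `∇_s e = −force/#motif` (own-sublattice terms cancel by `g ↔ −g`),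
`d/dt e((1+tB)P) = virial P B`, dominated differentiation under `∑'`. -/
theorem stub_frozenDescent :
    ∀ P : PC, ∀ ε > (0 : ℝ), ∀ ρ > (0 : ℝ), ∃ P' : PC,
      e P' ≤ e P ∧ ndFrac P' = ndFrac P ∧ fdFrac P' = fdFrac P ∧ Equilibrated ε ρ P' := by
  sorry

/-- **stub S2 — CLEAN NEAR COERCIVITY ON EQUILIBRIA (size L–XL; crux-implied: `cleanNear_of_crux`).**
There are `c, ε, ρ > 0` such that every `(ε, ρ)`-equilibrated periodic `P` ALL of whose motif sites are
`7/100`-near satisfies `ePer + c·ndFrac(P) ≤ e(P)`.  Intended proof (same-word card, K1 `NearRegimeCoercivity`,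
restricted to equilibria): robust layer lemma at `7/100` (all shells near ⇒ `P.points` is a bi-Lipschitz image of
`barlowStacking a h w` for a periodic Hägg word `w`; tree: exact case `eq_barlowStacking_of_layer`); reference
`P♮` = relaxation of `P`'s OWN word with free cell METRIC (r1-1 sharpen 1 / r1-2 sharpen 2: a frozen-lattice
reference yields 0); `e(P) − e(P♮) ≥ c_w⟨T⟩ − (cubic)` with `c_w` the generalized phonon gap (kit j005679:
0.264–0.355; r1-3 N2: k → 0 limit 0.516 hcp / 0.455 fcc), `T_x > (a/20)²` at every `1/20`-defective site,
plus an EOS inequality for scale-defective near sites (the free scale window contains the dilation spinodal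
1.0768 — r1-1 sharpen 2, r1-3 sharpen 3: NOT a quadratic-form event; margin ×60); then `comparative` with
0714.  What equilibrium adds: unpinned near sites are exact elastic solutions given the pinned set (no mushy
middle), so `⟨T⟩` is carried by the pinned sites' Green's-function tails — but on the binding family (hcp
threshold shuffle, every site pinned, `g* ≲ 4.3e-3` at azimuth 30°, r1-3 N1) the hypothesis is VACUOUS and S2
is K1 verbatim.  Why it might fail: anharmonic single-bond / odd cubic multi-bond terms at 5–7 % distortion
(V‴(1) = −126 vs V″(1) = 6; r1-3 sharpen 1) or a soft shell mode of some long polytype (j005679: none among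
fcc/hcp/dhcp/6H/9R). -/
theorem stub_cleanNearCoercivity :
    ∃ c > (0 : ℝ), ∃ ε > (0 : ℝ), ∃ ρ > (0 : ℝ), ∀ P : PC, Equilibrated ε ρ P →
      (∀ s ∈ P.motif, Near (7 / 100) P s) → ePer + c * ndFrac P ≤ e P := by
  sorry

/-- **stub S3 — ISOLATED NEAR DEFECTS PAY (contaminated world, near side, LOCAL rigidity; size XL;
crux-implied: `isolated_of_crux`).** There are `c > 0`, `R ≥ 1`, `ε, ρ > 0` such that every `(ε, ρ)`-equilibrated
`P` with at least one far-defective site satisfies `ePer + c·#(near-defective motif sites at distance ≥ R from every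
far-defective point)/#motif ≤ e(P)`.  Intended proof: a near-defective site `R`-isolated from the junk sits in a ball
of radius `R` of `7/100`-near material (locally a bi-Lipschitz Barlow stacking by the robust layer lemma); the LOCAL
(finite-range, null-Lagrangian-corrected) form of the phonon gap of S2 charges it `c` out of the energy inside the
ball — an SOS/Fejér–Riesz factorisation of `D_w(k) − c·T_w(k)` in the monomials `e^{ik·h} − 1` (same-word card (iv),
"collar stars … seed for round 2"), the flux through the sphere being paid by the `R⁻³` tail allowance and the
`ePer`-comparison done on a supercell patch as in S2.  What equilibrium adds: off the pinned set the displacement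
field in the ball is an exact (ε-)elastic solution (the card's "no mushy middle"), so a POINTWISE lower bound at the
pinned centre is a statement about discrete elastic Green's functions, not about arbitrary fields (Gårding alone
would not localise).  NOT obtainable from S2 by global surgery: excising junk and patching with perfect material is
topologically obstructed around dislocation cores (Burgers circuit), which is why the local form is registered as
its own statement.  Why it might fail: a finite-range matrix SOS certificate for `D_w − cT_w` need not exist
(nonnegative ≠ SOS for trigonometric polynomials in three variables), forcing `R → ∞`; and the robust layer lemma at
`7/100` exists in tree only in the exact case (`eq_barlowStacking_of_layer`). -/
theorem stub_isolatedNearDefectsPay :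
    ∃ c > (0 : ℝ), ∃ R ≥ (1 : ℝ), ∃ ε > (0 : ℝ), ∃ ρ > (0 : ℝ), ∀ P : PC, Equilibrated ε ρ P →
      0 < fdFrac P → ePer + c * (((isolatedNearDefSet R P).card : ℝ) / (P.motif.card : ℝ)) ≤ e P := by
  sorry

/-- **stub S5 — COLLAR COUNT (pure packing geometry; size M; TRUE, provable now).** There is `C` such that for
all `R ≥ 1` and every periodic `P`, the number of `7/100`-near motif sites within distance `< R` of some far-defective
point of `P` is at most `C·R³·#farDefSet(P)`.  Proof: (a) a `7/100`-near site `s` has EXACTLY twelve points of `P` in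
`closedBall s (6/5) ∖ {s}` (`card_eq_twelve_of_shellCloseTo`), each `η`-matched after rescaling by `a⁻¹`,
`a ∈ [9/10, 11/10]`, to a unit vector, hence at distance `∈ [a(1 − η), a(1 + η)] ⊆ [0.837, 1.177]` from `s`
(`one_le_dist_of_mem_fcc/hcpKissingPattern`-type norms of pattern points = 1); so NO point of `P` lies within `0.837`
of `s`, and near points of `P.points` are centres of pairwise disjoint balls of radius `0.418`; (b) volume count: at
most `((R + 0.42)/0.418)³ ≤ 40 R³` near points of `P.points` within `R` of any given point (`R ≥ 1`); (c) torus
bookkeeping: statuses are `G`-invariant (`shell P (s + g) = shell P s` for `g ∈ P.lattice`), so a collar site `s`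
with far witness `y = y₀ + g`, `y₀ ∈ farDefSet P`, maps injectively to the pair `(y₀, s − g)` with `s − g` a near
point of `P.points` within `R` of `y₀` (injective because motif points are inequivalent mod `G`); sum over `y₀`.
`C = 64` works.  Reusable verbatim by the same-word line's collar glue. -/
theorem stub_collarCount :
    ∃ C : ℝ, ∀ R : ℝ, 1 ≤ R → ∀ P : PC,
      ((collarSet R P).card : ℝ) ≤ C * R ^ 3 * ((farDefSet P).card : ℝ) := by
  sorry

/-- **stub S4 — FAR HEALING ON EQUILIBRIA (contaminated world, far side; size XL; HARDEST; crux-implied: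
`farHealing_of_crux`).** There are `c, ε, ρ > 0` such that every `(ε, ρ)`-equilibrated `P` with junk satisfies
`ePer + c·fdFrac(P) ≤ e(P)`: each far-defective site pays `c` against the periodic infimum, near-defective sites
being forgiven.  Numerics: `c ≤ 8.0e-3` (hcp shuffle just past the `7/100` seam at azimuth 30°, r1-3 N1 × (7/5)² ×
0.83) — the far engine must resolve `~10⁻²` relative to `e(hcp) = −0.7176`, not `5·10⁻³`, and never `ePer`
exactly: intended proof is RELATIVE (r1-2 sharpen 3) — exhibit a periodic `Q` with `e(Q) + c·fdFrac(P) ≤ e(P)`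
(cut junk ∪ collar out of a supercell of `P`, patch with the relaxation of the surrounding word, or certify the
route's edge- and vertex-star LP at `10⁻²` slack on junk ∪ first collar) and conclude by `comparative` + 0714.  What
equilibrium adds (the card's (iii)(b), r1-3 sharpen): at every robust junk star the three force-balance rows
`Σ_y V'(r_y) ê_y = 0 ± ε` and, for robustly classified `P`, the six zero-stress rows `virial = 0 ± ε` are VALID LP
constraints — they kill rattler, porous and lopsided stars and every flatness-feasible but mechanically unrealisable
froth statistics (Coxeter's `{3,3,5.1}` with all bonds at 1), while the genuine competitors bcc (excess 0.031), A15/σ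
(~10⁻²) are equilibria and survive, as they must.  Why it might fail: a non-Barlow periodic EQUILIBRIUM within
`o(fdFrac)` of `e(hcp)` (Frank–Kasper approximants sit only ~10⁻² above; first-order coupling of junk to a strained
near matrix ≈ 0.03 per interface site, same-word (iv)) or LP leakage at the 10⁻² scale (Hales's Delaunay stars
leaked at 5·10⁻⁴: margin ×20 only). -/
theorem stub_farHealingOnEquilibria :
    ∃ c > (0 : ℝ), ∃ ε > (0 : ℝ), ∃ ρ > (0 : ℝ), ∀ P : PC, Equilibrated ε ρ P →
      0 < fdFrac P → ePer + c * fdFrac P ≤ e P := by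
  sorry

/-! ## §4 Sorry-free glue -/

theorem motif_card_pos (P : PC) : 0 < (P.motif.card : ℝ) :=
  Nat.cast_pos.2 (Finset.card_pos.2 P.motif_nonempty)

theorem ndFrac_nonneg (P : PC) : 0 ≤ ndFrac P := div_nonneg (Nat.cast_nonneg _) (Nat.cast_nonneg _)

theorem fdFrac_nonneg (P : PC) : 0 ≤ fdFrac P := div_nonneg (Nat.cast_nonneg _) (Nat.cast_nonneg _)

/-- `#def = #nearDef + #farDef` (a partition by the `7/100` status). -/
theorem card_defectSet (P : PC) : (defectSet P).card = (nearDefSet P).card + (farDefSet P).card := by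
  unfold nearDefSet farDefSet
  rw [Finset.card_filter_add_card_filter_not]

theorem defectFrac_eq (P : PC) : defectFrac P = ndFrac P + fdFrac P := by
  unfold defectFrac ndFrac fdFrac
  rw [card_defectSet, Nat.cast_add, add_div]

theorem pscAt_iff (g : ℝ) (P : PC) : PSCAt g P ↔ ePer + g * defectFrac P ≤ e P := by
  unfold PSCAt defectFrac
  rw [mul_div_assoc]

/-- Nearness is monotone in the tolerance (so free ⇒ `7/100`-near). -/
theorem Near.mono {η η' : ℝ} (hη : η ≤ η') {P : PC} {s : E3} (h : Near η P s) : Near η' P s := by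
  obtain ⟨a, ha1, ha2, hclose⟩ := h
  refine ⟨a, ha1, ha2, ?_⟩
  rcases hclose with ⟨A, hA⟩ | ⟨A, hA⟩
  · exact Or.inl ⟨A, hA.mono hη⟩
  · exact Or.inr ⟨A, hA.mono hη⟩

/-- No far-defective site ⇒ every motif site is `7/100`-near (free sites are `1/20`-near, a fortiori). -/
theorem near_of_fdFrac_eq_zero {P : PC} (h : fdFrac P = 0) : ∀ s ∈ P.motif, Near (7 / 100) P s := by
  intro s hs
  have hcard : (farDefSet P).card = 0 := by
    unfold fdFrac at h
    rcases (div_eq_zero_iff.1 h) with h0 | h0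
    · exact_mod_cast h0
    · exact absurd h0 (motif_card_pos P).ne'
  have hempty : farDefSet P = ∅ := Finset.card_eq_zero.1 hcard
  by_contra hns
  by_cases hfree : IsFree P s
  · exact hns (Near.mono (by norm_num) hfree)
  · have hmem : s ∈ farDefSet P := by
      unfold farDefSet defectSet
      simp only [Finset.mem_filter]
      exact ⟨⟨hs, hfree⟩, hns⟩
    rw [hempty] at hmem
    exact absurd hmem (Finset.notMem_empty s)

/-- Robustness is antitone in the radius … -/
theorem Robust.anti {ρ ρ' : ℝ} (h : ρ ≤ ρ') {P : PC} {s : E3} (hR : Robust ρ' P s) : Robust ρ P s :=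
  fun t P' ht hm => hR t P' (lt_of_lt_of_le ht h) hm

theorem MetricRobust.anti {ρ ρ' : ℝ} (h : ρ ≤ ρ') {P : PC} (hR : MetricRobust ρ' P) : MetricRobust ρ P :=
  fun A P'' hA hpts => hR A P'' (lt_of_lt_of_le hA h) hpts

/-- … so being equilibrated is monotone UP in both parameters. -/
theorem Equilibrated.mono {ε ε' ρ ρ' : ℝ} (hε : ε ≤ ε') (hρ : ρ ≤ ρ') {P : PC}
    (h : Equilibrated ε ρ P) : Equilibrated ε' ρ' P := by
  refine ⟨fun s hs hR => ?_, fun hM B => ?_⟩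
  · exact (h.1 s hs (hR.anti hρ)).trans hε
  · exact (h.2 (hM.anti hρ) B).trans (mul_le_mul_of_nonneg_right hε (norm_nonneg B))

/-- **The comparative principle** (how S2–S4 are meant to be proved: never evaluate `ePer`): a periodic
competitor `Q` beating `P` by the charge closes the inequality, given `BddBelow` (shared item 0714
`CrysPeriodicBddBelow`, proved sorry-free in the disprover's evidence `PeriodicStability.lean`). -/
theorem comparative (hbdd : BddBelow (Set.range fun Q : PC => Q.energyPerParticle lennardJones))
    {charge : ℝ} {P Q : PC} (hQ : e Q + charge ≤ e P) : ePer + charge ≤ e P := by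
  have h1 : ePer ≤ e Q := ciInf_le hbdd Q
  linarith

/-- **Regime gluing (pure real arithmetic).** In the contaminated world the two one-sided inequalities
combine by the convex combination `λ = c'/(2(A + c'))`. -/
theorem glue_contaminated {X nd fd c A c' : ℝ} (_hc : 0 < c) (hA : 0 ≤ A) (hc' : 0 < c')
    (hnd : 0 ≤ nd) (hfd : 0 ≤ fd)
    (h1 : c * nd - A * fd ≤ X) (h2 : c' * fd ≤ X) :
    min (c' / (2 * (A + c')) * c) (c' / 2) * (nd + fd) ≤ X := by
  set l : ℝ := c' / (2 * (A + c')) with hl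
  have hApos : 0 < A + c' := by linarith
  have hl0 : 0 < l := by rw [hl]; positivity
  have hl1 : l ≤ 1 / 2 := by
    rw [hl, div_le_iff₀ (by positivity)]
    nlinarith
  have hkey : l * (A + c') = c' / 2 := by
    rw [hl]; field_simp
  -- λ·h1 + (1-λ)·h2
  have H1 : l * (c * nd - A * fd) ≤ l * X := mul_le_mul_of_nonneg_left h1 hl0.le
  have H2 : (1 - l) * (c' * fd) ≤ (1 - l) * X := mul_le_mul_of_nonneg_left h2 (by linarith)
  have hm1 : min (l * c) (c' / 2) * nd ≤ l * c * nd :=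
    mul_le_mul_of_nonneg_right (min_le_left _ _) hnd
  have hm2 : min (l * c) (c' / 2) * fd ≤ c' / 2 * fd :=
    mul_le_mul_of_nonneg_right (min_le_right _ _) hfd
  have hsum : l * c * nd + c' / 2 * fd ≤ X := by nlinarith
  calc min (l * c) (c' / 2) * (nd + fd)
      = min (l * c) (c' / 2) * nd + min (l * c) (c' / 2) * fd := by ring
    _ ≤ l * c * nd + c' / 2 * fd := add_le_add hm1 hm2
    _ ≤ X := hsum

/-- **Collar bookkeeping**: every near-defective site is either `R`-isolated or in the `R`-collar. -/
theorem card_nearDefSet_le (R : ℝ) (P : PC) :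
    (nearDefSet P).card ≤ (isolatedNearDefSet R P).card + (collarSet R P).card := by
  have hsplit := Finset.card_filter_add_card_filter_not (s := nearDefSet P) (fun s => Isolated R P s)
  have hsub : ((nearDefSet P).filter fun s => ¬ Isolated R P s) ⊆ collarSet R P := by
    intro s hs
    unfold collarSet
    unfold nearDefSet defectSet at hs
    simp only [Finset.mem_filter] at hs ⊢
    exact ⟨hs.1.1.1, hs.1.2, hs.2⟩
  have hle := Finset.card_le_card hsub
  unfold isolatedNearDefSet
  omega

/-- **S3 ⊕ S5 ⇒ near coercivity modulo the collar** (with `A = c · max C 0 · R³`). -/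
theorem modCollar_of_isolated_of_collar (hI : IsolatedNearDefectsPay) (hK : CollarCount) :
    NearCoercivityModCollar := by
  obtain ⟨c, hc, R, hR, ε, hε, ρ, hρ, H⟩ := hI
  obtain ⟨C, HK⟩ := hK
  refine ⟨c, hc, c * max C 0 * R ^ 3, by positivity, ε, hε, ρ, hρ, fun P hP hpos => ?_⟩
  have hm := motif_card_pos P
  have h1 := H P hP hpos
  -- counts
  have hcount : ((nearDefSet P).card : ℝ) ≤
      ((isolatedNearDefSet R P).card : ℝ) + ((collarSet R P).card : ℝ) := by
    exact_mod_cast card_nearDefSet_le R P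
  have hcollar : ((collarSet R P).card : ℝ) ≤ max C 0 * R ^ 3 * ((farDefSet P).card : ℝ) := by
    refine (HK R hR P).trans ?_
    have hR3 : 0 ≤ R ^ 3 := by positivity
    have : C * R ^ 3 ≤ max C 0 * R ^ 3 := mul_le_mul_of_nonneg_right (le_max_left _ _) hR3
    exact mul_le_mul_of_nonneg_right this (Nat.cast_nonneg _)
  -- pass to fractions
  have hfrac : c * ndFrac P - c * max C 0 * R ^ 3 * fdFrac P ≤
      c * (((isolatedNearDefSet R P).card : ℝ) / (P.motif.card : ℝ)) := by
    unfold ndFrac fdFrac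
    rw [mul_div_assoc', mul_div_assoc', mul_div_assoc', ← sub_div, div_le_div_iff_of_pos_right hm]
    nlinarith [mul_le_mul_of_nonneg_left (hcount.trans (add_le_add le_rfl hcollar)) hc.le]
  linarith

/-- **C⁺ from the three regime statements** (clean world: S2; contaminated world: (S3 ⊕ S5) ⊕ S4). -/
theorem cruxOnEquilibria_of_parts (hN : CleanNearCoercivity) (hC : NearCoercivityModCollar)
    (hF : FarHealingOnEquilibria) : CruxOnEquilibria := by
  obtain ⟨c₁, hc₁, ε₁, hε₁, ρ₁, hρ₁, H₁⟩ := hN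
  obtain ⟨c₂, hc₂, A, hA, ε₂, hε₂, ρ₂, hρ₂, H₂⟩ := hC
  obtain ⟨c₃, hc₃, ε₃, hε₃, ρ₃, hρ₃, H₃⟩ := hF
  set g₂ : ℝ := min (c₃ / (2 * (A + c₃)) * c₂) (c₃ / 2) with hg₂
  have hg₂pos : 0 < g₂ := by
    rw [hg₂]
    refine lt_min ?_ (by positivity)
    have : 0 < A + c₃ := by linarith
    positivity
  refine ⟨min c₁ g₂, lt_min hc₁ hg₂pos, min ε₁ (min ε₂ ε₃), by positivity, min ρ₁ (min ρ₂ ρ₃),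
    by positivity, fun P hP => ?_⟩
  have hnd := ndFrac_nonneg P
  have hfd := fdFrac_nonneg P
  rw [defectFrac_eq]
  rcases (fdFrac_nonneg P).eq_or_lt with h0 | hpos
  · -- clean world
    have hnear := near_of_fdFrac_eq_zero h0.symm
    have hP₁ : Equilibrated ε₁ ρ₁ P := hP.mono (min_le_left _ _) (min_le_left _ _)
    have := H₁ P hP₁ hnear
    rw [← h0, add_zero]
    have hmin : min c₁ g₂ * ndFrac P ≤ c₁ * ndFrac P := mul_le_mul_of_nonneg_right (min_le_left _ _) hnd
    linarith
  · -- contaminated world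
    have hP₂ : Equilibrated ε₂ ρ₂ P :=
      hP.mono ((min_le_right _ _).trans (min_le_left _ _)) ((min_le_right _ _).trans (min_le_left _ _))
    have hP₃ : Equilibrated ε₃ ρ₃ P :=
      hP.mono ((min_le_right _ _).trans (min_le_right _ _)) ((min_le_right _ _).trans (min_le_right _ _))
    have h1 := H₂ P hP₂ hpos
    have h2 := H₃ P hP₃ hpos
    have hglue := glue_contaminated (X := e P - ePer) hc₂ hA hc₃ hnd hfd (by linarith) (by linarith)
    have hmin : min c₁ g₂ * (ndFrac P + fdFrac P) ≤ g₂ * (ndFrac P + fdFrac P) :=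
      mul_le_mul_of_nonneg_right (min_le_right _ _) (by positivity)
    rw [hg₂] at hmin
    linarith

/-- **The reduction** (card: `reduction_to_equilibria`; here with EXACT fractions, so no `ε`-bookkeeping):
descent + crux-on-equilibria ⇒ the crux, unfolded. -/
theorem of_descent (hD : FrozenDescent) (hE : CruxOnEquilibria) : ∃ g : ℝ, 0 < g ∧ ∀ P : PC, PSCAt g P := by
  obtain ⟨g, hg, ε, hε, ρ, hρ, H⟩ := hE
  refine ⟨g, hg, fun P => (pscAt_iff g P).2 ?_⟩
  obtain ⟨P', hle, hnd, hfd, hEq⟩ := hD P ε hε ρ hρ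
  have := H P' hEq
  rw [defectFrac_eq] at this ⊢
  rw [hnd, hfd] at this
  linarith

/-- **The decomposition, closed form (no sorry)**, concluding the crux UNFOLDED (only
`PeriodicStarCoercivity_of` below concludes the route decl by name):
descent → clean near → isolated-near-defects-pay → collar count → far healing → crux. -/
theorem of_parts (hD : FrozenDescent) (hN : CleanNearCoercivity) (hI : IsolatedNearDefectsPay)
    (hK : CollarCount) (hF : FarHealingOnEquilibria) : ∃ g : ℝ, 0 < g ∧ ∀ P : PC, PSCAt g P :=
  of_descent hD (cruxOnEquilibria_of_parts hN (modCollar_of_isolated_of_collar hI hK) hF)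

/-! ## §5 Certificates: every regime stub is IMPLIED by the crux (weaker targets; nothing false is chased
unless the crux itself is false), and `C⁺` is EQUIVALENT to the crux modulo the (true) descent. -/

theorem cruxOnEquilibria_of_crux (h : ∃ g : ℝ, 0 < g ∧ ∀ P : PC, PSCAt g P) : CruxOnEquilibria := by
  obtain ⟨g, hg, H⟩ := h
  exact ⟨g, hg, 1, one_pos, 1, one_pos, fun P _ => (pscAt_iff g P).1 (H P)⟩

theorem cleanNear_of_crux (h : ∃ g : ℝ, 0 < g ∧ ∀ P : PC, PSCAt g P) : CleanNearCoercivity := by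
  obtain ⟨g, hg, H⟩ := h
  refine ⟨g, hg, 1, one_pos, 1, one_pos, fun P _ _ => ?_⟩
  have := (pscAt_iff g P).1 (H P)
  rw [defectFrac_eq] at this
  nlinarith [fdFrac_nonneg P]

theorem modCollar_of_crux (h : ∃ g : ℝ, 0 < g ∧ ∀ P : PC, PSCAt g P) : NearCoercivityModCollar := by
  obtain ⟨g, hg, H⟩ := h
  refine ⟨g, hg, 0, le_rfl, 1, one_pos, 1, one_pos, fun P _ _ => ?_⟩
  have := (pscAt_iff g P).1 (H P)
  rw [defectFrac_eq] at this
  nlinarith [fdFrac_nonneg P]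

/-- Isolated near-defective sites are defective sites, so S3 is crux-implied too (any `R`). -/
theorem isolated_of_crux (h : ∃ g : ℝ, 0 < g ∧ ∀ P : PC, PSCAt g P) : IsolatedNearDefectsPay := by
  obtain ⟨g, hg, H⟩ := h
  refine ⟨g, hg, 1, le_rfl, 1, one_pos, 1, one_pos, fun P _ _ => ?_⟩
  have hP := (pscAt_iff g P).1 (H P)
  have hm := motif_card_pos P
  have hsub : isolatedNearDefSet 1 P ⊆ defectSet P := by
    intro s hs
    unfold isolatedNearDefSet nearDefSet at hs
    exact (Finset.mem_filter.1 (Finset.mem_filter.1 hs).1).1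
  have hle : (((isolatedNearDefSet 1 P).card : ℝ) / (P.motif.card : ℝ)) ≤ defectFrac P := by
    unfold defectFrac
    exact div_le_div_of_nonneg_right (by exact_mod_cast Finset.card_le_card hsub) hm.le
  nlinarith [mul_le_mul_of_nonneg_left hle hg.le]

theorem farHealing_of_crux (h : ∃ g : ℝ, 0 < g ∧ ∀ P : PC, PSCAt g P) : FarHealingOnEquilibria := by
  obtain ⟨g, hg, H⟩ := h
  refine ⟨g, hg, 1, one_pos, 1, one_pos, fun P _ _ => ?_⟩
  have := (pscAt_iff g P).1 (H P)
  rw [defectFrac_eq] at this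
  nlinarith [ndFrac_nonneg P]

/-- Given the descent, `C⁺ ↔ crux` (the card's Transfer is an honest equivalence — triage Probe (b)(c)). -/
theorem cruxOnEquilibria_iff (hD : FrozenDescent) :
    CruxOnEquilibria ↔ ∃ g : ℝ, 0 < g ∧ ∀ P : PC, PSCAt g P :=
  ⟨of_descent hD, cruxOnEquilibria_of_crux⟩

/-! ## §6 Skeleton theorem -/

/-- **Skeleton theorem**: the crux BY NAME from the five registered stubs. -/
theorem PeriodicStarCoercivity_of :
    Summit.AtomisticToContinuum.Crystallization.Theses.ReggeStarCoercivity.PeriodicStarCoercivity :=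
  psc_iff.2 (of_parts stub_frozenDescent stub_cleanNearCoercivity stub_isolatedNearDefectsPay
    stub_collarCount stub_farHealingOnEquilibria)

end Summit.AtomisticToContinuum.Crystallization.Cruxes.PeriodicStarCoercivity.PinnedEquilibriaReduction

end
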